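import Literature.NumberTheory.LFunctions.DirichletPolyBilinearMVT
import HarnessLib

/-!
# Titchmarsh's Lemma 9.21: `∫_T^{T₂} z₁(t) z̄₁(t) (n/m)^{it} dt`

Topic `Literature/NumberTheory/LFunctions`. Everything in this file is PROVED (no definitions, no
named facts).

With `S₁(t) = ∑_{μ ≤ P} μ^{-1/2-it}` (so that `z₁ z̄₁ = S₁ S̄₁`) and coprime `m, n`, Titchmarsh's
Lemma 9.21 (*The Theory of the Riemann Zeta-Function*, 2nd ed., §9.21) evaluates

  `∫_T^{T+U} z₁(t) z̄₁(t) (n/m)^{it} dt = (U/(mn)^{1/2}) ∑_{r ≤ τ/M} 1/r + O{T^{1/2} M² log(MT)}`,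

`M = max(m, n)`: the integrand is the product of the Dirichlet polynomials `∑_ν ν^{-1/2} (nν)^{it}`
and `conj ∑_μ μ^{-1/2} (mμ)^{it}` on the common frequency set `k ≤ mnP`, the diagonal `nν = mμ`,
i.e. `ν = mr`, `μ = nr`, `r ≤ P/M`, gives the main term, and the off-diagonal terms are bounded by
the (polarised) Montgomery–Vaughan mean value theorem
(`Literature.NumberTheory.LFunctions.norm_integral_dirichletPoly_mul_conj_sub_le`), which gives the
sharper error `3712 P (m + n)` in place of the printed `O(T^{1/2} M² log MT)`:

* `Literature.NumberTheory.LFunctions.TwistedMoment.lemma921` — for all real `T₁ ≤ T₂`... (any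
  `T₁, T₂`), `‖∫_{T₁}^{T₂} S₁ S̄₁ e^{it log(n/m)} dt − ((T₂−T₁)/(mn)^{1/2}) ∑_{r ≤ P/max(m,n)} 1/r‖`
  `≤ 3712 P (m + n)`.

## References

* E. C. Titchmarsh, *The Theory of the Riemann Zeta-Function*, 2nd ed. (rev. D. R. Heath-Brown),
  Oxford 1986, §9.21, Lemma 9.21. [cite: Titchmarsh1986, Lemma 9.21]
* H. L. Montgomery, R. C. Vaughan, *Hilbert's inequality*, J. London Math. Soc. (2) 8 (1974) 73–82.
-/

noncomputable section

open Finset Real Complex MeasureTheory intervalIntegral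
open scoped ComplexConjugate

namespace Literature.NumberTheory.LFunctions.TwistedMoment

/-! ### `k^{it}` for natural `k` -/

/-- `k^{it} = e^{it log k}` for `k ≥ 1`. [folklore] -/
theorem natCast_cpow_mul_I_eq_cexp {k : ℕ} (hk : 0 < k) (t : ℝ) :
    (k : ℂ) ^ ((t : ℂ) * I) = cexp (I * t * Real.log k) := by
  rw [Complex.cpow_def_of_ne_zero (by exact_mod_cast hk.ne'), ← Complex.natCast_log]
  congr 1; ring

/-- `(nν)^{it} = e^{it log n} e^{it log ν}`. [folklore] -/
theorem natCast_mul_cpow_mul_I_eq {n ν : ℕ} (hn : 0 < n) (hν : 0 < ν) (t : ℝ) :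
    ((n * ν : ℕ) : ℂ) ^ ((t : ℂ) * I) = cexp (I * t * Real.log n) * cexp (I * t * Real.log ν) := by
  rw [natCast_cpow_mul_I_eq_cexp (Nat.mul_pos hn hν), ← Complex.exp_add, Nat.cast_mul,
    Real.log_mul (by exact_mod_cast hn.ne') (by exact_mod_cast hν.ne')]
  push_cast; ring_nf

/-! ### The two Dirichlet polynomials on the common frequency set -/

/-- Reindexing `k = nν`: for `n ≥ 1`, `N ≥ nP` and any `F`,
`∑_{k ≤ N} [n ∣ k, 1 ≤ k/n ≤ P] F(k/n, k) = ∑_{ν ≤ P} F(ν, nν)`. [folklore] -/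
theorem sum_Icc_dvd_reindex {n P N : ℕ} (hn : 0 < n) (hN : n * P ≤ N) (F : ℕ → ℕ → ℂ) :
    ∑ k ∈ Finset.Icc 1 N, (if n ∣ k ∧ 1 ≤ k / n ∧ k / n ≤ P then F (k / n) k else 0) =
      ∑ ν ∈ Finset.Icc 1 P, F ν (n * ν) := by
  rw [← Finset.sum_filter]
  have hinj : Set.InjOn (fun ν => n * ν) (Finset.Icc 1 P : Finset ℕ) :=
    fun a _ b _ h => Nat.eq_of_mul_eq_mul_left hn h
  have himage : (Finset.Icc 1 N).filter (fun k => n ∣ k ∧ 1 ≤ k / n ∧ k / n ≤ P) =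
      (Finset.Icc 1 P).image (fun ν => n * ν) := by
    ext k
    simp only [Finset.mem_filter, Finset.mem_Icc, Finset.mem_image]
    constructor
    · rintro ⟨⟨h1, h2⟩, ⟨ν, rfl⟩, h3, h4⟩
      rw [Nat.mul_div_cancel_left ν hn] at h3 h4
      exact ⟨ν, ⟨h3, h4⟩, rfl⟩
    · rintro ⟨ν, ⟨h3, h4⟩, rfl⟩
      rw [Nat.mul_div_cancel_left ν hn]
      refine ⟨⟨Nat.mul_pos hn h3, ?_⟩, dvd_mul_right n ν, h3, h4⟩
      exact (Nat.mul_le_mul_left n h4).trans hN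
  rw [himage, Finset.sum_image hinj]
  refine Finset.sum_congr rfl fun ν _ => ?_
  rw [Nat.mul_div_cancel_left ν hn]

/-- **Titchmarsh's Lemma 9.21** (with the Montgomery–Vaughan error term): for coprime `m, n ≥ 1`,
`P ≥ 0` and real `T₁, T₂`, with `S₁(t) = ∑_{μ ≤ P} μ^{-1/2} e^{-it log μ}`,
`‖∫_{T₁}^{T₂} S₁(t) conj(S₁(t)) e^{it(log n − log m)} dt − ((T₂ − T₁)/(mn)^{1/2}) ∑_{r ≤ P/max(m,n)} 1/r‖`
`  ≤ 3712 P (m + n)`. [cite: Titchmarsh1986, Lemma 9.21] -/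
theorem lemma921 (P : ℕ) {m n : ℕ} (hm : 0 < m) (hn : 0 < n) (hcop : Nat.Coprime m n) (T₁ T₂ : ℝ) :
    ‖(∫ t in T₁..T₂,
        (∑ μ ∈ Finset.Icc 1 P, (((μ : ℝ) ^ (-(1 / 2 : ℝ)) : ℝ) : ℂ) * cexp (-(I * t * Real.log μ)))
        * conj (∑ μ ∈ Finset.Icc 1 P, (((μ : ℝ) ^ (-(1 / 2 : ℝ)) : ℝ) : ℂ) * cexp (-(I * t * Real.log μ)))
        * cexp (I * t * ((Real.log n - Real.log m : ℝ) : ℂ)))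
      - (((T₂ - T₁) / Real.sqrt (m * n) * ∑ r ∈ Finset.Icc 1 (P / max m n), (1 : ℝ) / r : ℝ) : ℂ)‖ ≤
      3712 * P * (m + n) := by
  have hmR : (0 : ℝ) < m := by exact_mod_cast hm
  have hnR : (0 : ℝ) < n := by exact_mod_cast hn
  set N := n * m * P with hNdef
  have hNn : n * P ≤ N := by
    rw [hNdef, mul_comm n m, mul_assoc]; exact Nat.le_mul_of_pos_left _ hm
  have hNm : m * P ≤ N := by
    rw [hNdef, mul_assoc]; exact Nat.le_mul_of_pos_left _ hn
  -- the coefficient vectors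
  set w : ℕ → ℂ := fun ν => ((((ν : ℝ) ^ (-(1 / 2 : ℝ)) : ℝ) : ℂ)) with hw
  set a : ℕ → ℂ := fun k => if n ∣ k ∧ 1 ≤ k / n ∧ k / n ≤ P then w (k / n) else 0 with ha
  set b : ℕ → ℂ := fun k => if m ∣ k ∧ 1 ≤ k / m ∧ k / m ≤ P then w (k / m) else 0 with hb
  set S₁ : ℝ → ℂ := fun t => ∑ μ ∈ Finset.Icc 1 P, w μ * cexp (-(I * t * Real.log μ)) with hS₁
  have hwreal : ∀ ν, conj (w ν) = w ν := fun ν => Complex.conj_ofReal _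
  -- `conj S₁(t) = ∑ w_ν e^{it log ν}`
  have hconjS : ∀ t : ℝ, conj (S₁ t) = ∑ ν ∈ Finset.Icc 1 P, w ν * cexp (I * t * Real.log ν) := by
    intro t
    simp only [hS₁, map_sum, map_mul, hwreal, ← Complex.exp_conj, map_neg, Complex.conj_I,
      Complex.conj_ofReal]
    refine Finset.sum_congr rfl fun ν _ => ?_
    congr 1; ring
  -- the Dirichlet polynomials `A`, `B`
  have hA : ∀ t : ℝ, ∑ k ∈ Finset.Icc 1 N, a k * (k : ℂ) ^ ((t : ℂ) * I) =
      cexp (I * t * Real.log n) * conj (S₁ t) := by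
    intro t
    rw [hconjS, Finset.mul_sum]
    have := sum_Icc_dvd_reindex hn hNn (fun ν k => w ν * (k : ℂ) ^ ((t : ℂ) * I))
    simp only [ha]
    rw [show (∑ k ∈ Finset.Icc 1 N, (if n ∣ k ∧ 1 ≤ k / n ∧ k / n ≤ P then w (k / n) else 0) * (k : ℂ) ^ ((t : ℂ) * I))
        = ∑ k ∈ Finset.Icc 1 N, (if n ∣ k ∧ 1 ≤ k / n ∧ k / n ≤ P then w (k / n) * (k : ℂ) ^ ((t : ℂ) * I) else 0)
        from Finset.sum_congr rfl fun k _ => by split_ifs <;> simp, this]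
    refine Finset.sum_congr rfl fun ν hν => ?_
    rw [natCast_mul_cpow_mul_I_eq hn (Finset.mem_Icc.1 hν).1]
    ring
  have hB : ∀ t : ℝ, ∑ k ∈ Finset.Icc 1 N, b k * (k : ℂ) ^ ((t : ℂ) * I) =
      cexp (I * t * Real.log m) * conj (S₁ t) := by
    intro t
    rw [hconjS, Finset.mul_sum]
    have := sum_Icc_dvd_reindex hm hNm (fun ν k => w ν * (k : ℂ) ^ ((t : ℂ) * I))
    simp only [hb]
    rw [show (∑ k ∈ Finset.Icc 1 N, (if m ∣ k ∧ 1 ≤ k / m ∧ k / m ≤ P then w (k / m) else 0) * (k : ℂ) ^ ((t : ℂ) * I))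
        = ∑ k ∈ Finset.Icc 1 N, (if m ∣ k ∧ 1 ≤ k / m ∧ k / m ≤ P then w (k / m) * (k : ℂ) ^ ((t : ℂ) * I) else 0)
        from Finset.sum_congr rfl fun k _ => by split_ifs <;> simp, this]
    refine Finset.sum_congr rfl fun ν hν => ?_
    rw [natCast_mul_cpow_mul_I_eq hm (Finset.mem_Icc.1 hν).1]
    ring
  -- the integrand is `A(t) conj(B(t))`
  have hintegrand : ∀ t : ℝ, S₁ t * conj (S₁ t) * cexp (I * t * ((Real.log n - Real.log m : ℝ) : ℂ)) =
      (∑ k ∈ Finset.Icc 1 N, a k * (k : ℂ) ^ ((t : ℂ) * I)) *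
        conj (∑ k ∈ Finset.Icc 1 N, b k * (k : ℂ) ^ ((t : ℂ) * I)) := by
    intro t
    rw [hA, hB, map_mul, Complex.conj_conj, ← Complex.exp_conj]
    simp only [map_mul, Complex.conj_I, Complex.conj_ofReal]
    have : cexp (I * t * ((Real.log n - Real.log m : ℝ) : ℂ)) =
        cexp (I * t * Real.log n) * cexp (-I * t * Real.log m) := by
      rw [← Complex.exp_add]; push_cast; ring_nf
    rw [this, show -I * (t : ℂ) * (Real.log m : ℂ) = -I * t * Real.log m by rfl]
    ring_nf
  -- the diagonal
  have hdiag : ∑ k ∈ Finset.Icc 1 N, a k * conj (b k) =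
      (((1 / Real.sqrt (m * n)) * ∑ r ∈ Finset.Icc 1 (P / max m n), (1 : ℝ) / r : ℝ) : ℂ) := by
    -- `a k conj(b k) ≠ 0` only for `k = mnr`
    have hterm : ∀ k ∈ Finset.Icc 1 N, a k * conj (b k) =
        if (m * n) ∣ k ∧ 1 ≤ k / (m * n) ∧ k / (m * n) ≤ P / max m n then
          (((1 / Real.sqrt (m * n)) * (1 / ((k / (m * n) : ℕ) : ℝ)) : ℝ) : ℂ) else 0 := by
      intro k hk
      simp only [ha, hb]
      by_cases hcond : (m * n) ∣ k ∧ 1 ≤ k / (m * n) ∧ k / (m * n) ≤ P / max m n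
      · obtain ⟨⟨r, rfl⟩, h1, h2⟩ := hcond
        have hmn : 0 < m * n := Nat.mul_pos hm hn
        rw [Nat.mul_div_cancel_left r hmn] at h1 h2 ⊢
        have hrP : r ≤ P / max m n := h2
        have hr_m : m * r ≤ P := by
          have := (Nat.le_div_iff_mul_le (lt_max_of_lt_left hm)).1 hrP
          calc m * r ≤ max m n * r := Nat.mul_le_mul_right r (le_max_left _ _)
            _ = r * max m n := mul_comm _ _
            _ ≤ P := this
        have hr_n : n * r ≤ P := by
          have := (Nat.le_div_iff_mul_le (lt_max_of_lt_left hm)).1 hrP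
          calc n * r ≤ max m n * r := Nat.mul_le_mul_right r (le_max_right _ _)
            _ = r * max m n := mul_comm _ _
            _ ≤ P := this
        have e1 : m * n * r / n = m * r := by
          rw [mul_assoc, mul_comm n r, ← mul_assoc, Nat.mul_div_cancel _ hn]
        have e2 : m * n * r / m = n * r := by
          rw [mul_assoc, Nat.mul_div_cancel_left _ hm]
        have c1 : n ∣ m * n * r ∧ 1 ≤ m * n * r / n ∧ m * n * r / n ≤ P := by
          refine ⟨⟨m * r, by ring⟩, ?_, ?_⟩ <;> rw [e1]
          · exact Nat.mul_pos hm h1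
          · exact hr_m
        have c2 : m ∣ m * n * r ∧ 1 ≤ m * n * r / m ∧ m * n * r / m ≤ P := by
          refine ⟨⟨n * r, by ring⟩, ?_, ?_⟩ <;> rw [e2]
          · exact Nat.mul_pos hn h1
          · exact hr_n
        rw [if_pos c1, if_pos c2, if_pos ⟨⟨r, rfl⟩, h1, hrP⟩, e1, e2, hwreal]
        simp only [hw]
        rw [← Complex.ofReal_mul]
        congr 1
        have hr0 : (0 : ℝ) < r := by exact_mod_cast h1
        rw [Nat.cast_mul, Nat.cast_mul, Real.mul_rpow hmR.le hr0.le, Real.mul_rpow hnR.le hr0.le,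
          Real.rpow_neg hmR.le, Real.rpow_neg hnR.le, Real.rpow_neg hr0.le, ← Real.sqrt_eq_rpow,
          ← Real.sqrt_eq_rpow, ← Real.sqrt_eq_rpow, Real.sqrt_mul hmR.le]
        field_simp
        rw [Real.sq_sqrt hr0.le]
      · rw [if_neg hcond]
        -- at least one of the two factors vanishes
        by_contra hne
        have hne' : a k * conj (b k) ≠ 0 := by simpa [ha, hb] using hne
        have ha0 : a k ≠ 0 := left_ne_zero_of_mul hne'
        have hb0 : conj (b k) ≠ 0 := right_ne_zero_of_mul hne'
        have hb0' : b k ≠ 0 := fun h => hb0 (by rw [h, map_zero])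
        simp only [ha, hb, ne_eq, ite_eq_right_iff, not_forall] at ha0 hb0'
        obtain ⟨⟨hnk, h1n, hPn⟩, -⟩ := ha0
        obtain ⟨⟨hmk, h1m, hPm⟩, -⟩ := hb0'
        apply hcond
        have hmnk : m * n ∣ k := Nat.Coprime.mul_dvd_of_dvd_of_dvd hcop hmk hnk
        obtain ⟨r, rfl⟩ := hmnk
        have hmn : 0 < m * n := Nat.mul_pos hm hn
        rw [Nat.mul_div_cancel_left r hmn]
        have e1 : m * n * r / n = m * r := by
          rw [mul_assoc, mul_comm n r, ← mul_assoc, Nat.mul_div_cancel _ hn]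
        have e2 : m * n * r / m = n * r := by
          rw [mul_assoc, Nat.mul_div_cancel_left _ hm]
        rw [e1] at h1n hPn
        rw [e2] at hPm
        refine ⟨dvd_mul_right _ _, ?_, ?_⟩
        · exact Nat.pos_of_ne_zero fun h => by simp [h] at h1n
        · rw [Nat.le_div_iff_mul_le (lt_max_of_lt_left hm)]
          rcases le_total m n with hle | hle
          · rw [max_eq_right hle, mul_comm]; exact hPm
          · rw [max_eq_left hle, mul_comm]; exact hPn
    rw [Finset.sum_congr rfl hterm]
    have hmn : 0 < m * n := Nat.mul_pos hm hn
    have hNmn : m * n * (P / max m n) ≤ N := by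
      rw [hNdef, mul_comm n m]
      exact Nat.mul_le_mul_left _ (Nat.div_le_self _ _)
    rw [sum_Icc_dvd_reindex hmn hNmn (fun r _ => ((((1 / Real.sqrt (m * n)) * (1 / (r : ℝ)) : ℝ) : ℂ))),
      Complex.ofReal_mul, Complex.ofReal_sum, Finset.mul_sum]
    refine Finset.sum_congr rfl fun r _ => ?_
    push_cast; ring
  -- the error sums
  have herr : ∑ k ∈ Finset.Icc 1 N, (k : ℝ) * (‖a k‖ ^ 2 + ‖b k‖ ^ 2) = P * (n + m) := by
    have hwsq : ∀ ν : ℕ, 1 ≤ ν → ‖w ν‖ ^ 2 = 1 / ν := by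
      intro ν hν
      have hν0 : (0 : ℝ) < ν := by exact_mod_cast hν
      simp only [hw, Complex.norm_real, Real.norm_eq_abs]
      rw [abs_of_nonneg (Real.rpow_nonneg hν0.le _), ← Real.rpow_natCast, ← Real.rpow_mul hν0.le]
      norm_num
      rw [Real.rpow_neg_one]
    have hsa : ∑ k ∈ Finset.Icc 1 N, (k : ℝ) * ‖a k‖ ^ 2 = P * n := by
      have : ∀ k ∈ Finset.Icc 1 N, ((k : ℝ) * ‖a k‖ ^ 2 : ℝ) =
          Complex.re (if n ∣ k ∧ 1 ≤ k / n ∧ k / n ≤ P then (((n * (k / n) : ℕ) : ℝ) * ‖w (k / n)‖ ^ 2 : ℝ) else 0 : ℂ) := by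
        intro k hk
        simp only [ha]
        split_ifs with h
        · obtain ⟨⟨q, rfl⟩, -, -⟩ := h
          rw [Nat.mul_div_cancel_left q hn, Complex.ofReal_re]
        · simp
      rw [Finset.sum_congr rfl this, ← Complex.re_sum,
        sum_Icc_dvd_reindex hn hNn (fun ν _ => (((n * ν : ℕ) : ℝ) * ‖w ν‖ ^ 2 : ℝ)), Complex.re_sum]
      simp only [Complex.ofReal_re]
      rw [Finset.sum_congr rfl fun ν hν => by
        rw [hwsq ν (Finset.mem_Icc.1 hν).1, Nat.cast_mul,
          show (n : ℝ) * ν * (1 / ν) = n by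
            have : (0:ℝ) < ν := by exact_mod_cast (Finset.mem_Icc.1 hν).1
            field_simp]]
      rw [Finset.sum_const, Nat.card_Icc, nsmul_eq_mul]; push_cast; ring
    have hsb : ∑ k ∈ Finset.Icc 1 N, (k : ℝ) * ‖b k‖ ^ 2 = P * m := by
      have : ∀ k ∈ Finset.Icc 1 N, ((k : ℝ) * ‖b k‖ ^ 2 : ℝ) =
          Complex.re (if m ∣ k ∧ 1 ≤ k / m ∧ k / m ≤ P then (((m * (k / m) : ℕ) : ℝ) * ‖w (k / m)‖ ^ 2 : ℝ) else 0 : ℂ) := by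
        intro k hk
        simp only [hb]
        split_ifs with h
        · obtain ⟨⟨q, rfl⟩, -, -⟩ := h
          rw [Nat.mul_div_cancel_left q hm, Complex.ofReal_re]
        · simp
      rw [Finset.sum_congr rfl this, ← Complex.re_sum,
        sum_Icc_dvd_reindex hm hNm (fun ν _ => (((m * ν : ℕ) : ℝ) * ‖w ν‖ ^ 2 : ℝ)), Complex.re_sum]
      simp only [Complex.ofReal_re]
      rw [Finset.sum_congr rfl fun ν hν => by
        rw [hwsq ν (Finset.mem_Icc.1 hν).1, Nat.cast_mul,
          show (m : ℝ) * ν * (1 / ν) = m by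
            have : (0:ℝ) < ν := by exact_mod_cast (Finset.mem_Icc.1 hν).1
            field_simp]]
      rw [Finset.sum_const, Nat.card_Icc, nsmul_eq_mul]; push_cast; ring
    have hsplit : ∀ k ∈ Finset.Icc 1 N, (k : ℝ) * (‖a k‖ ^ 2 + ‖b k‖ ^ 2) = k * ‖a k‖ ^ 2 + k * ‖b k‖ ^ 2 :=
      fun k _ => mul_add _ _ _
    rw [Finset.sum_congr rfl hsplit, Finset.sum_add_distrib, hsa, hsb]; ring
  -- apply the bilinear mean value theorem
  have key := norm_integral_dirichletPoly_mul_conj_sub_le N a b T₁ T₂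
  rw [herr, hdiag] at key
  rw [intervalIntegral.integral_congr (fun t _ => hintegrand t)]
  refine le_trans (le_of_eq ?_) (key.trans (le_of_eq (by ring)))
  congr 1
  push_cast
  ring

end Literature.NumberTheory.LFunctions.TwistedMoment
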